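import Literature.AlgebraicGeometry.Resolution.FundamentalInequalityApprox
import HarnessLib

/-!
# The fundamental inequality `∑ eᵢ fᵢ ≤ n`: the inequality relative to a common coarsening

Topic: `Literature/AlgebraicGeometry/Resolution` (valued function fields). The heart of the
classical proof of the fundamental inequality `n ≥ ∑ᵢ eᵢ fᵢ` (Kuhlmann 2010, §1, (1); the named
fact `FundamentalInequality` of `GeneralizedStability.lean`), PROVED: Zariski–Samuel's
`K`-linear independence argument for independent extensions (O. Zariski, P. Samuel,
*Commutative Algebra* II, Ch. VI §11, Thm. 19, case (a), pp. 56–57 of the 1960 edition), run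
RELATIVE TO A COMMON COARSENING `V` — which is how the general (dependent) case reduces to the
independent one (loc. cit., case (b) and the Note pp. 67–70; Bourbaki, *Alg. Comm.* VI §8 no. 3,
Thm. 1): for valuation rings `V₁, …, V_r ≤ V` of `L`, pairwise generating `V` and all different
from `V`, containing a common valuation ring `O` of `K` (`L/K` finite),

  `∑ₐ e(Vₐ/K) f(Vₐ/K) ≤ e(V/K) f(V/K)`            (`sum_ramificationIndex_mul_inertiaDegree_le_of_sup_eq`).

Proof: with `e(Vₐ/K) = mₐ e(V/K)` realised by units `ξ_{a,1}, …, ξ_{a,mₐ}` of `V`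
(`exists_repr_ramificationIndex_eq_mul`), made small at the `V_b`, `b ≠ a`, by relative
approximation (`exists_unit_valuation_le_of_sup_eq`), and `y_{a,1}, …, y_{a,fₐ} ∈ ⋂_b V_b` lifting a
`K̃`-basis of `κ(Vₐ)` (residue approximation `exists_mem_interRing_approx`), the residues in
`κ(V)` of the `∑ₐ mₐ fₐ` products `ξ_{a,σ} y_{a,t}` are linearly independent over `K̃ ⊆ κ(V)`:
a relation `Z = ∑ c ξ y ∈ 𝔪(V)` with coefficients in `K`, one of them a unit of `V`, is
normalised at the coefficient of largest `O`-value; at the corresponding `V_{a₀}` the terms of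
the other `Vₐ` are small and the `V_{a₀}`-terms have pairwise distinct values (the inner sums
`∑ₜ cₜ y_{a₀,t}` have values in `|K^×|`, `exists_valuation_sum_eq_valuation_coeff`), so
`|Z|_{a₀} ≥ |ξ_{a₀,σ₀}|_{a₀}`, whence `|Z|_V ≥ 1` by coarsening — a contradiction.

## Sources

* O. Zariski, P. Samuel, *Commutative Algebra* II (1960), Ch. VI §11, Thm. 19 and Note.
* N. Bourbaki, *Algèbre commutative* Ch. VI §8 no. 3, Thm. 1.
-/

noncomputable section

open IsLocalRing

namespace Literature.AlgebraicGeometry.Resolution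

universe u

variable (K : Type u) {L : Type u} [Field K] [Field L] [Algebra K L]

omit K in
/-- For a proper subring `Va < V` of valuation rings of `L` there is a unit of `V` lying in the
maximal ideal of `Va` (the inverse of any element of `V ∖ Va`). [folklore] -/
theorem exists_unit_valuation_lt_one {Va V : ValuationSubring L} (h : Va ≤ V) (hne : Va ≠ V) :
    ∃ x : L, V.valuation x = 1 ∧ Va.valuation x < 1 := by
  obtain ⟨z, hzV, hzVa⟩ : ∃ z, z ∈ V ∧ z ∉ Va := by
    by_contra hcon
    push Not at hcon
    exact hne (le_antisymm h fun z hz => hcon z hz)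
  have hz0 : z ≠ 0 := fun h0 => hzVa (h0 ▸ Va.zero_mem)
  have hziVa : z⁻¹ ∈ Va := (Va.mem_or_inv_mem z).resolve_left hzVa
  refine ⟨z⁻¹, ?_, ?_⟩
  · exact valuation_eq_one_of_mem_of_inv_mem V (inv_ne_zero hz0) (h hziVa) (by rwa [inv_inv])
  · have h1 : 1 < Va.valuation z := lt_of_not_ge fun hle => hzVa ((Va.valuation_le_one_iff z).mp hle)
    rw [map_inv₀]
    exact (inv_lt_one₀ (zero_lt_one.trans h1)).mpr h1

/-- **The fundamental inequality relative to a common coarsening** (Zariski–Samuel II, Ch. VI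
§11, Thm. 19, the linear-independence argument of case (a) run under a coarsening as in case
(b) / Bourbaki VI §8 no. 3, Thm. 1): let `L/K` be finite, `V` a valuation ring of `L`,
`V₁, …, V_r ≤ V` valuation rings of `L` all different from `V` with `Vₐ ⊔ V_b = V` for `a ≠ b`,
and `O` a valuation ring of `K` with `O ⊆ Vₐ ∩ K` for all `a`. Then
`∑ₐ e(Vₐ/K) f(Vₐ/K) ≤ e(V/K) f(V/K)`. PROVED (see the module docstring).
[cite: ZariskiSamuel1960, Ch. VI §11, Thm. 19] -/
theorem sum_ramificationIndex_mul_inertiaDegree_le_of_sup_eq [FiniteDimensional K L]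
    {A : Type*} [Fintype A] (V : ValuationSubring L) (Va : A → ValuationSubring L)
    (hle : ∀ a, Va a ≤ V) (hne : ∀ a, Va a ≠ V) (hsup : ∀ a b, a ≠ b → Va a ⊔ Va b = V)
    (O : ValuationSubring K) (hO : ∀ a, O ≤ (Va a).comap (algebraMap K L)) :
    ∑ a, ramificationIndex K (Va a) * inertiaDegree K (Va a) ≤
      ramificationIndex K V * inertiaDegree K V := by
  classical
  rcases isEmpty_or_nonempty A with hA | hA
  · simp
  -- the `Vₐ` are pairwise incomparable
  have hinc : ∀ a b, Va a ≤ Va b → a = b := fun a b hab => by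
    by_contra h
    exact hne b ((sup_eq_right.mpr hab).symm.trans (hsup a b h))
  /- Step 1: units `ξ₀ a σ` of `V` representing the cosets, `e(Va a) = m a * e(V)`. -/
  choose m ξ₀ hξ₀V hξ₀dist hm using fun a => exists_repr_ramificationIndex_eq_mul K (hle a)
  have hξ₀0 : ∀ a σ, ξ₀ a σ ≠ 0 := fun a σ h0 => by
    have h1 := hξ₀V a σ
    rw [h0, map_zero] at h1
    exact zero_ne_one h1
  /- Step 2: lifts `y a t ∈ ⋂_b V_b` of a `K̃`-basis of `κ(Va a)`. -/
  let f : A → ℕ := fun a => Module.finrank (residueSubfield K (Va a)) (ResidueField (Va a))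
  have hfin : ∀ a, Module.Finite (residueSubfield K (Va a)) (ResidueField (Va a)) := fun a =>
    (ramificationIndex_mul_inertiaDegree_le_finrank K (Va a)).2.1
  let B : ∀ a, Module.Basis (Fin (f a)) (residueSubfield K (Va a)) (ResidueField (Va a)) :=
    fun a => Module.finBasis _ _
  have hy₀ex : ∀ a t, ∃ y₀ : Va a, residue (Va a) y₀ = B a t := fun a t => residue_surjective _
  choose y₀ hy₀ using hy₀ex
  have hyex : ∀ a t, ∃ x : L, (∀ b, x ∈ Va b) ∧ (Va a).valuation (x - y₀ a t) < 1 := fun a t => by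
    obtain ⟨x, hxB, hxa, -⟩ := exists_mem_interRing_approx Va hinc a (y₀ a t).2
    exact ⟨x, (mem_interRing Va).mp hxB, hxa⟩
  choose y hyB hya using hyex
  have hyres : ∀ a t, residue (Va a) ⟨y a t, hyB a t a⟩ = B a t := fun a t => by
    rw [← hy₀ a t, ← sub_eq_zero, ← map_sub, residue_eq_zero_iff,
      ValuationSubring.valuation_lt_one_iff]
    exact hya a t
  have hyLI : ∀ a, LinearIndependent (residueSubfield K (Va a))
      fun t => residue (Va a) ⟨y a t, hyB a t a⟩ := fun a => by
    have heq : (fun t => residue (Va a) ⟨y a t, hyB a t a⟩) = B a := funext (hyres a)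
    rw [heq]
    exact (B a).linearIndependent
  /- Step 3: approximation of the `ξ₀`: `ξ a σ = ξ₀ a σ * u a σ` small at `V_b`, `b ≠ a`. -/
  have hdex : ∀ a (σ : Fin (m a)) b, ∃ d : L, V.valuation d = 1 ∧ (b ≠ a → ∀ σ' : Fin (m b),
      (Va b).valuation (ξ₀ a σ) * (Va b).valuation d < (Va b).valuation (ξ₀ b σ')) := by
    intro a σ b
    by_cases hba : b = a
    · exact ⟨1, by simp, fun h => (h hba).elim⟩
    obtain ⟨M, hMV, hMb⟩ := exists_unit_valuation_lt_one (hle b) (hne b)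
    rcases isEmpty_or_nonempty (Fin (m b)) with hmb | hmb
    · exact ⟨M, hMV, fun _ σ' => (IsEmpty.false σ').elim⟩
    obtain ⟨σm, -, hσm⟩ := Finset.univ.exists_min_image
      (fun σ' => (Va b).valuation (ξ₀ b σ')) Finset.univ_nonempty
    refine ⟨ξ₀ b σm / ξ₀ a σ * M, ?_, fun _ σ' => ?_⟩
    · rw [map_mul, map_div₀, hξ₀V, hξ₀V, hMV, div_one, one_mul]
    · have hb0 : (Va b).valuation (ξ₀ a σ) ≠ 0 := (Valuation.ne_zero_iff _).mpr (hξ₀0 a σ)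
      have hbm0 : (Va b).valuation (ξ₀ b σm) ≠ 0 := (Valuation.ne_zero_iff _).mpr (hξ₀0 b σm)
      calc (Va b).valuation (ξ₀ a σ) * (Va b).valuation (ξ₀ b σm / ξ₀ a σ * M)
          = (Va b).valuation (ξ₀ b σm) * (Va b).valuation M := by
            rw [map_mul, map_div₀, ← mul_assoc, mul_div_cancel₀ _ hb0]
        _ < (Va b).valuation (ξ₀ b σm) * 1 :=
            mul_lt_mul_of_pos_left hMb (zero_lt_iff.mpr hbm0)
        _ = (Va b).valuation (ξ₀ b σm) := mul_one _
        _ ≤ (Va b).valuation (ξ₀ b σ') := hσm σ' (Finset.mem_univ _)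
  choose d hdV hdlt using hdex
  have huex : ∀ a (σ : Fin (m a)), ∃ u : L, (∀ b, u ∈ Va b) ∧ (Va a).valuation u = 1 ∧
      ∀ b, b ≠ a → (Va b).valuation u ≤ (Va b).valuation (d a σ b) := fun a σ =>
    exists_unit_valuation_le_of_sup_eq V Va hle hne hsup a (d a σ) (hdV a σ)
  choose u huB hua hub using huex
  have hu0 : ∀ a σ, u a σ ≠ 0 := fun a σ h0 => by
    have h1 := hua a σ
    rw [h0, map_zero] at h1
    exact zero_ne_one h1
  have huV : ∀ a σ, V.valuation (u a σ) = 1 := fun a σ => by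
    have hinv : (u a σ)⁻¹ ∈ Va a :=
      ((Va a).valuation_le_one_iff _).mp (by rw [map_inv₀, hua, inv_one])
    exact valuation_eq_one_of_mem_of_inv_mem V (hu0 a σ) (hle a (huB a σ a)) (hle a hinv)
  obtain ⟨ξ, hξdef⟩ : ∃ ξ : ∀ a, Fin (m a) → L, ∀ a σ, ξ a σ = ξ₀ a σ * u a σ :=
    ⟨_, fun _ _ => rfl⟩
  have hξV : ∀ a σ, V.valuation (ξ a σ) = 1 := fun a σ => by
    rw [hξdef, map_mul, hξ₀V, huV, mul_one]
  have hξa : ∀ a σ, (Va a).valuation (ξ a σ) = (Va a).valuation (ξ₀ a σ) := fun a σ => by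
    rw [hξdef, map_mul, hua, mul_one]
  have hξlt : ∀ a σ b σ', b ≠ a → (Va b).valuation (ξ a σ) < (Va b).valuation (ξ b σ') := by
    intro a σ b σ' hba
    rw [hξa b σ']
    calc (Va b).valuation (ξ a σ) = (Va b).valuation (ξ₀ a σ) * (Va b).valuation (u a σ) := by
          rw [hξdef, map_mul]
      _ ≤ (Va b).valuation (ξ₀ a σ) * (Va b).valuation (d a σ b) :=
          mul_le_mul' le_rfl (hub a σ b hba)
      _ < _ := hdlt a σ b hba σ'
  have hξmem : ∀ a σ, ξ a σ ∈ V := fun a σ => (V.valuation_le_one_iff _).mp (hξV a σ).le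
  have hξ0 : ∀ a σ, ξ a σ ≠ 0 := fun a σ => by
    rw [hξdef]
    exact mul_ne_zero (hξ₀0 a σ) (hu0 a σ)
  /- Step 4: the residues of the products `ξ a σ * y a t` are `K̃`-linearly independent. -/
  let ι := Σ a, Fin (m a) × Fin (f a)
  let z : ι → V := fun i =>
    ⟨ξ i.1 i.2.1 * y i.1 i.2.2, V.mul_mem _ _ (hξmem _ _) (hle i.1 (hyB _ _ _))⟩
  have hLI : LinearIndependent (residueSubfield K V) fun i => residue V (z i) := by
    rw [Fintype.linearIndependent_iff]
    intro g hg
    by_contra hcon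
    push Not at hcon
    obtain ⟨j, hj⟩ := hcon
    -- lift the coefficients to `K`
    have hlift : ∀ i, ∃ c : K, ∃ hc : algebraMap K L c ∈ V,
        residue V ⟨algebraMap K L c, hc⟩ = (g i : ResidueField V) := fun i =>
      (mem_residueSubfield_iff K V _).mp (g i).2
    choose c hcV hcg using hlift
    have hcj0 : residue V ⟨_, hcV j⟩ ≠ 0 := by
      rw [hcg]
      exact fun h0 => hj (Subtype.ext h0)
    have hcjV : V.valuation (algebraMap K L (c j)) = 1 :=
      (V.valuation_eq_one_iff _).mp ((residue_ne_zero_iff_isUnit _).mp hcj0)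
    have hcjne : c j ≠ 0 := fun h0 => by
      rw [h0, map_zero, map_zero] at hcjV
      exact zero_ne_one hcjV
    -- the pivot: a coefficient of largest `O`-value
    obtain ⟨⟨a₀, σ₀, t₀⟩, -, hpmax⟩ :=
      Finset.univ.exists_max_image (fun i => O.valuation (c i)) ⟨j, Finset.mem_univ _⟩
    set p : ι := ⟨a₀, σ₀, t₀⟩ with hp
    have hcp0 : c p ≠ 0 := fun h0 => by
      have h1 := hpmax j (Finset.mem_univ _)
      rw [h0, map_zero, le_zero_iff, map_eq_zero] at h1
      exact hcjne h1
    have hrat : ∀ i, c i / c p ∈ O := fun i => (O.valuation_le_one_iff _).mp (by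
      rw [map_div₀]
      exact div_le_one_of_le₀ (hpmax i (Finset.mem_univ _)) zero_le)
    have hratb : ∀ i b, (Va b).valuation (algebraMap K L (c i / c p)) ≤ 1 := fun i b =>
      ((Va b).valuation_le_one_iff _).mpr (hO b (hrat i))
    have hcpV : V.valuation (algebraMap K L (c p)) = 1 := by
      obtain ⟨a⟩ := hA
      have h1 : V.valuation (algebraMap K L (c j / c p)) ≤ 1 :=
        (V.valuation_le_one_iff _).mpr (hle a (hO a (hrat j)))
      rw [map_div₀, map_div₀, hcjV] at h1
      have hp0 : V.valuation (algebraMap K L (c p)) ≠ 0 :=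
        (Valuation.ne_zero_iff _).mpr ((map_ne_zero _).mpr hcp0)
      have h2 : 1 ≤ V.valuation (algebraMap K L (c p)) := by
        rwa [one_div, inv_le_one₀ (zero_lt_iff.mpr hp0)] at h1
      exact le_antisymm ((V.valuation_le_one_iff _).mpr (hcV p)) h2
    -- normalised coefficients `c' i = c i / c p`, `c' p = 1`
    obtain ⟨c', hc'def⟩ : ∃ c' : ι → K, ∀ i, c' i = c i / c p := ⟨_, fun _ => rfl⟩
    have hc'p : c' p = 1 := by rw [hc'def, div_self hcp0]
    have hc'b : ∀ i b, (Va b).valuation (algebraMap K L (c' i)) ≤ 1 := fun i b => by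
      rw [hc'def]
      exact hratb i b
    -- the relation `Z = ∑ c i z i` lies in `𝔪(V)`
    have hZ : V.valuation (∑ i, algebraMap K L (c i) * (z i : L)) < 1 := by
      have hsumV : (∑ i, (⟨algebraMap K L (c i), hcV i⟩ : V) * z i) ∈ IsLocalRing.maximalIdeal V := by
        rw [← residue_eq_zero_iff, map_sum, ← hg]
        refine Finset.sum_congr rfl fun i _ => ?_
        rw [map_mul, hcg]
        rfl
      have h1 := (ValuationSubring.valuation_lt_one_iff V _).mp hsumV
      simpa only [AddSubmonoidClass.coe_finsetSum, MulMemClass.coe_mul] using h1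
    have hZ' : V.valuation (∑ i, algebraMap K L (c' i) * (z i : L)) < 1 := by
      have heq : ∑ i, algebraMap K L (c' i) * (z i : L) =
          (∑ i, algebraMap K L (c i) * (z i : L)) / algebraMap K L (c p) := by
        rw [div_eq_mul_inv, Finset.sum_mul]
        refine Finset.sum_congr rfl fun i _ => ?_
        rw [hc'def, map_div₀]
        ring
      rw [heq, map_div₀, hcpV, div_one]
      exact hZ
    -- regroup `Z' = ∑ₐ G a`, `G a = ∑_{σ,t} c' ξ y`
    let F : ι → L := fun i => algebraMap K L (c' i) * (z i : L)
    let G : A → L := fun a => ∑ st : Fin (m a) × Fin (f a), F ⟨a, st⟩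
    have hFG : ∑ i, F i = G a₀ + ∑ a ∈ ({a₀}ᶜ : Finset A), G a := by
      rw [Fintype.sum_sigma F, Fintype.sum_eq_add_sum_compl a₀]
    -- the terms of the other `Vₐ` are small at `V_{a₀}`
    have hv0 : (Va a₀).valuation (ξ a₀ σ₀) ≠ 0 := (Valuation.ne_zero_iff _).mpr (hξ0 a₀ σ₀)
    have hR : (Va a₀).valuation (∑ a ∈ ({a₀}ᶜ : Finset A), G a) <
        (Va a₀).valuation (ξ a₀ σ₀) := by
      refine Valuation.map_sum_lt _ hv0 fun a ha => ?_
      have hne' : a₀ ≠ a := fun h => by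
        rw [Finset.mem_compl, Finset.mem_singleton] at ha
        exact ha h.symm
      refine Valuation.map_sum_lt _ hv0 fun st _ => ?_
      change (Va a₀).valuation (algebraMap K L (c' ⟨a, st⟩) * (ξ a st.1 * y a st.2)) < _
      rw [map_mul, map_mul]
      calc (Va a₀).valuation (algebraMap K L (c' ⟨a, st⟩)) *
            ((Va a₀).valuation (ξ a st.1) * (Va a₀).valuation (y a st.2))
          ≤ 1 * ((Va a₀).valuation (ξ a st.1) * 1) := by
            refine mul_le_mul' (hc'b _ a₀) (mul_le_mul' le_rfl ?_)
            exact ((Va a₀).valuation_le_one_iff _).mpr (hyB a st.2 a₀)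
        _ = (Va a₀).valuation (ξ a st.1) := by rw [one_mul, mul_one]
        _ < (Va a₀).valuation (ξ a₀ σ₀) := hξlt a st.1 a₀ σ₀ hne'
    -- the `V_{a₀}`-terms: `G a₀ = ∑_σ ξ σ S σ` with inner sums `S σ`
    let S : Fin (m a₀) → L := fun σ => ∑ t, algebraMap K L (c' ⟨a₀, (σ, t)⟩) * y a₀ t
    have hGS : G a₀ = ∑ σ, ξ a₀ σ * S σ := by
      change ∑ st : Fin (m a₀) × Fin (f a₀), F ⟨a₀, st⟩ = _
      rw [Fintype.sum_prod_type]
      refine Finset.sum_congr rfl fun σ _ => ?_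
      rw [Finset.mul_sum]
      refine Finset.sum_congr rfl fun t _ => ?_
      change algebraMap K L (c' ⟨a₀, (σ, t)⟩) * (ξ a₀ σ * y a₀ t) = _
      ring
    -- values of the non-zero inner sums
    have hrow : ∀ σ, (∃ t, c' ⟨a₀, (σ, t)⟩ ≠ 0) → ∃ q, c' ⟨a₀, (σ, q)⟩ ≠ 0 ∧
        (Va a₀).valuation (S σ) = (Va a₀).valuation (algebraMap K L (c' ⟨a₀, (σ, q)⟩)) ∧
        ∀ t, (Va a₀).valuation (algebraMap K L (c' ⟨a₀, (σ, t)⟩)) ≤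
          (Va a₀).valuation (algebraMap K L (c' ⟨a₀, (σ, q)⟩)) := fun σ hσ =>
      exists_valuation_sum_eq_valuation_coeff K (Va a₀) (fun t => (⟨y a₀ t, hyB a₀ t a₀⟩ : Va a₀))
        (hyLI a₀) (fun t => c' ⟨a₀, (σ, t)⟩) hσ
    let s : Finset (Fin (m a₀)) := Finset.univ.filter fun σ => ∃ t, c' ⟨a₀, (σ, t)⟩ ≠ 0
    have hσ₀ : σ₀ ∈ s := Finset.mem_filter.mpr ⟨Finset.mem_univ _, t₀, by
      change c' p ≠ 0
      rw [hc'p]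
      exact one_ne_zero⟩
    have hS0 : ∀ σ, σ ∉ s → S σ = 0 := fun σ hσ => by
      have h0 : ∀ t, c' ⟨a₀, (σ, t)⟩ = 0 := fun t => by
        by_contra ht
        exact hσ (Finset.mem_filter.mpr ⟨Finset.mem_univ _, t, ht⟩)
      change ∑ t, algebraMap K L (c' ⟨a₀, (σ, t)⟩) * y a₀ t = 0
      exact Finset.sum_eq_zero fun t _ => by rw [h0 t, map_zero, zero_mul]
    choose q hq0 hqv hqmax using fun σ : ↥s => hrow σ (Finset.mem_filter.mp σ.2).2
    -- the `V_{a₀}`-values of the non-zero terms `ξ σ S σ` are pairwise distinct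
    have hdist : ∀ σ (hσ : σ ∈ s) σ' (hσ' : σ' ∈ s), σ ≠ σ' →
        (Va a₀).valuation (ξ a₀ σ * S σ) ≠ (Va a₀).valuation (ξ a₀ σ' * S σ') := by
      intro σ hσ σ' hσ' hss heq
      apply hss
      rw [map_mul, map_mul, hξa, hξa, hqv ⟨σ, hσ⟩, hqv ⟨σ', hσ'⟩] at heq
      have hcq' : c' ⟨a₀, (σ', q ⟨σ', hσ'⟩)⟩ ≠ 0 := hq0 ⟨σ', hσ'⟩
      have hvq' : (Va a₀).valuation (algebraMap K L (c' ⟨a₀, (σ', q ⟨σ', hσ'⟩)⟩)) ≠ 0 :=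
        (Valuation.ne_zero_iff _).mpr ((map_ne_zero _).mpr hcq')
      refine hξ₀dist a₀ σ σ' (c' ⟨a₀, (σ, q ⟨σ, hσ⟩)⟩ / c' ⟨a₀, (σ', q ⟨σ', hσ'⟩)⟩)
        (div_ne_zero (hq0 ⟨σ, hσ⟩) hcq') ?_
      rw [map_div₀, map_div₀, div_mul_eq_mul_div, eq_div_iff hvq']
      exact heq.symm.trans (mul_comm _ _)
    -- hence `|G a₀|_{a₀} ≥ |ξ a₀ σ₀|_{a₀}`
    have hG : (Va a₀).valuation (ξ a₀ σ₀) ≤ (Va a₀).valuation (G a₀) := by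
      obtain ⟨σm, hσm, hmax⟩ :=
        s.exists_max_image (fun σ => (Va a₀).valuation (ξ a₀ σ * S σ)) ⟨σ₀, hσ₀⟩
      have hsum : G a₀ = ∑ σ ∈ s, ξ a₀ σ * S σ := by
        rw [hGS, ← Finset.sum_filter_add_sum_filter_not Finset.univ
          (fun σ => ∃ t, c' ⟨a₀, (σ, t)⟩ ≠ 0)]
        rw [Finset.sum_eq_zero (s := Finset.univ.filter fun σ => ¬∃ t, c' ⟨a₀, (σ, t)⟩ ≠ 0)
          (fun σ hσ => by
            rw [hS0 σ (fun hσ' => (Finset.mem_filter.mp hσ).2 (Finset.mem_filter.mp hσ').2),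
              mul_zero]), add_zero]
      have hval : (Va a₀).valuation (G a₀) = (Va a₀).valuation (ξ a₀ σm * S σm) := by
        rw [hsum]
        refine (Va a₀).valuation.map_sum_eq_of_lt hσm fun σ hσ => ?_
        obtain ⟨hσs, hσne⟩ := Finset.mem_sdiff.mp hσ
        rw [Finset.mem_singleton] at hσne
        exact lt_of_le_of_ne (hmax σ hσs) (hdist σ hσs σm hσm hσne)
      rw [hval]
      refine le_trans ?_ (hmax σ₀ hσ₀)
      rw [map_mul, hqv ⟨σ₀, hσ₀⟩]
      have h1 : (Va a₀).valuation (algebraMap K L (c' p)) ≤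
          (Va a₀).valuation (algebraMap K L (c' ⟨a₀, (σ₀, q ⟨σ₀, hσ₀⟩)⟩)) := hqmax ⟨σ₀, hσ₀⟩ t₀
      rw [hc'p, map_one, map_one] at h1
      calc (Va a₀).valuation (ξ a₀ σ₀) = (Va a₀).valuation (ξ a₀ σ₀) * 1 := (mul_one _).symm
        _ ≤ _ := mul_le_mul' le_rfl h1
    -- so `|Z'|_{a₀} ≥ |ξ a₀ σ₀|_{a₀}`, and coarsening to `V` gives `|Z'|_V ≥ 1`
    have hZa : (Va a₀).valuation (ξ a₀ σ₀) ≤ (Va a₀).valuation (∑ i, F i) := by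
      rw [hFG, Valuation.map_add_eq_of_lt_left _ (hR.trans_le hG)]
      exact hG
    have hmono := ValuationSubring.monotone_mapOfLE (Va a₀) V (hle a₀) hZa
    rw [ValuationSubring.mapOfLE_valuation_apply, ValuationSubring.mapOfLE_valuation_apply,
      hξV] at hmono
    exact absurd hZ' (not_lt.mpr hmono)
  /- Step 5: count. -/
  haveI : Module.Finite (residueSubfield K V) (ResidueField V) :=
    (ramificationIndex_mul_inertiaDegree_le_finrank K V).2.1
  have hcard := hLI.fintype_card_le_finrank
  rw [Fintype.card_sigma] at hcard
  simp only [Fintype.card_prod, Fintype.card_fin] at hcard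
  calc ∑ a, ramificationIndex K (Va a) * inertiaDegree K (Va a)
      = ∑ a, ramificationIndex K V * (m a * f a) := Finset.sum_congr rfl fun a _ => by
        rw [hm a]
        change _ * Module.finrank (residueSubfield K (Va a)) (ResidueField (Va a)) = _
        ring
    _ = ramificationIndex K V * ∑ a, m a * f a := by rw [Finset.mul_sum]
    _ ≤ ramificationIndex K V * inertiaDegree K V := Nat.mul_le_mul_left _ hcard

end Literature.AlgebraicGeometry.Resolution
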